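import Summits.AtomisticToContinuum.HydrodynamicLimit.Theorems.AnnealedZeroHorizonDefs
import Summits.AtomisticToContinuum.HydrodynamicLimit.Theorems.AnnealedZeroHorizonAnnealedWeakStrongHsRelEtaCoercive
import Summits.AtomisticToContinuum.HydrodynamicLimit.Theorems.AnnealedZeroHorizonAnnealedWeakStrongSmallRelEntropyFieldsCloseA
import Summits.AtomisticToContinuum.HydrodynamicLimit.Theorems.AnnealedZeroHorizonAnnealedWeakStrongSmallRelEntropyFieldsCloseB
import Literature.MathematicalPhysics.KineticTheory.HardSphereEulerProofs
import Literature.Analysis.FluidPDE.HardSphereTorusMeasure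
import Mathlib

/-!
# Crux `AnnealedWeakStrong` (stmt-AtomisticToContinuum-9258), line `registered` — stub S3b
# `stub_smallRelEntropyFieldsClose` (reshaped, junk-free currency)

Registered stub of the lead's reshaped skeleton (`Cruxes/AnnealedWeakStrong/Lines/birth.lean`, wave-1
integration 2026-08-17): `Sig.stub_smallRelEntropyFieldsClose := Sig.stub_hsRelEtaCoercive → … →
RelEntropyLIntSmallAt … t → FieldsCloseViaKernelsAt … t`. Proof by the S3b stub worker of the line
(`prover-line-stmt-AtomisticToContinuum-9258-c1`), landed by the lead.

Why the currency changed. The birth skeleton's `RelEntropySmallAt` uses the Bochner observable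
`relEntropyObs z = ∫ x, η_σ(U^k(Φ_t z)(x) | Ū(t,x)) dx` (junk `0` when the integrand is not `x`-integrable).
For every continuous kernel of small radius the mollified packing `ρ^k σ³` of hard-sphere configurations
ranges (by the only packing bound available without Kepler's theorem) over `[0, 8‖k‖_∞ ℓ³] ⊇ [0, 6/π]`, and on
`[3/(4π), 6/π]` nothing is known (or provable in the tree) about `hsExcessFreeEnergy` — it is
`≤ -log(1 - 4πη/3)` below `3/(4π)` (`LocalSecondLawNegative.hsExcessFreeEnergy_le`) and `0` above `6/π`
(`hsFreeVolume_eq_zero_of_dense`), while across close packing `√2 ∈ (3/(4π), 6/π)` local boundedness is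
Kepler-hard and physically false. Hence `x`-integrability of the coarse-grained entropy density is not
provable on a set of configurations that no hypothesis controls, and the Bochner form of the implication
cannot be proved. In the JUNK-FREE currency `RelEntropyLIntSmallAt` (iterated lower integral of
`ofReal η_σ(·|·)`, objects module `AnnealedZeroHorizonDefs`) the step goes through for ALL kernels with no
equation-of-state input beyond S3a: `RelEntropyLIntSmallAt → MeanFieldsCloseAt`
(`meanFieldsCloseAt_of_relEntropyLIntSmallAt`), hence `→ FieldsCloseViaKernelsAt`, from S3a
(`stub_hsRelEtaCoercive`, landed), the toolboxes `s3bKernelConeToolbox` / `s3bIntegrationToolbox` (landed,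
files `…SmallRelEntropyFieldsCloseA/B.lean`: polynomial kernels at every radius, a.s. pairwise distinct
velocities at every time, cone trichotomy of mollified states, integration lemmas) and the pointwise step
`stateDist_le_of_coercive`.

References: FjordholmEtAl2020 (Lemma 28), Dafermos1979, BrezinaFeireisl2018 (§3).
-/

noncomputable section

open MeasureTheory Filter Set Function
open scoped ENNReal Topology

namespace Summit.AtomisticToContinuum.HydrodynamicLimit.Theorems.AWS

open Literature.MathematicalPhysics.KineticTheory Literature.Analysis.FluidPDE

/-! ### S3b in the junk-free currency (iterated lower integral of `ofReal hsRelEta`) -/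

/-- Bounds of a continuous real function on `𝕋³`: attained minimum and maximum. -/
theorem exists_min_max_of_continuous {f : T3 → ℝ} (hf : Continuous f) :
    ∃ xm xM : T3, ∀ x, f xm ≤ f x ∧ f x ≤ f xM := by
  obtain ⟨xm, -, hm⟩ := isCompact_univ.exists_isMinOn univ_nonempty hf.continuousOn
  obtain ⟨xM, -, hM⟩ := isCompact_univ.exists_isMaxOn univ_nonempty hf.continuousOn
  exact ⟨xm, xM, fun x => ⟨hm (mem_univ x), hM (mem_univ x)⟩⟩

/-- `C / (N + 1) < r₀` eventually. -/
theorem eventually_div_succ_lt (C : ℝ) {r₀ : ℝ} (hr₀ : 0 < r₀) :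
    ∀ᶠ N : ℕ in atTop, C / ((N + 1 : ℕ) : ℝ) < r₀ := by
  have h : Tendsto (fun N : ℕ => C / ((N + 1 : ℕ) : ℝ)) atTop (𝓝 0) :=
    (tendsto_const_div_atTop_nhds_zero_nat C).comp (tendsto_add_atTop_nat 1)
  exact h.eventually_lt_const hr₀

/-- The density gap bounds the state distance from below: `|ρ − ρ̄| ≤ dist(U, V)`. -/
theorem abs_fst_sub_fst_le_stateDist (U V : State) : |U.1 - V.1| ≤ stateDist U V := by
  unfold stateDist
  have h1 := norm_nonneg (U.2.1 - V.2.1)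
  have h2 := abs_nonneg (U.2.2 - V.2.2)
  linarith

/-- **Pointwise step (d).** At a reference state `V` with `ρ̄ ≥ ρm`, a cone state `U` that is
physical or has density `≤ ρm/4` satisfies `dist(U,V) ≤ δ + (A/μ + B) η_σ(U|V)` as soon as
`δ ≤ ρm/2`, given the three conclusions of S3a at `V`: non-negativity at physical states, linear
growth `dist ≤ A + B η_σ`, and forcing `η_σ ≥ μ` at distance `≥ δ`. -/
theorem stateDist_le_of_coercive {σ : ℝ} {U V : State} {A B μ δ ρm : ℝ}
    (hA : 0 ≤ A) (hB : 0 ≤ B) (hμ : 0 < μ) (hδ : 0 ≤ δ) (hδρ : δ ≤ ρm / 2) (hV : ρm ≤ V.1)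
    (hc1 : 0 ≤ U.1)
    (hreal : ‖U.2.1‖ ^ 2 < 2 * U.1 * U.2.2 ∨ U.1 ≤ ρm / 4)
    (hpos : 0 < U.1 → ‖U.2.1‖ ^ 2 < 2 * U.1 * U.2.2 → 0 ≤ hsRelEta σ U V)
    (hlin : stateDist U V ≤ A + B * hsRelEta σ U V)
    (hfar : δ ≤ stateDist U V → μ ≤ hsRelEta σ U V) :
    stateDist U V ≤ δ + (A / μ + B) * hsRelEta σ U V := by
  have hgap := abs_fst_sub_fst_le_stateDist U V
  generalize hR : hsRelEta σ U V = R at *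
  generalize hD : stateDist U V = D at *
  by_cases hfarx : δ ≤ D
  · have hμle : μ ≤ R := hfar hfarx
    have hAK : A ≤ A / μ * R := by
      rw [div_mul_eq_mul_div, le_div_iff₀ hμ]
      exact mul_le_mul_of_nonneg_left hμle hA
    calc D ≤ A + B * R := hlin
      _ ≤ A / μ * R + B * R := by linarith
      _ = (A / μ + B) * R := by ring
      _ ≤ δ + (A / μ + B) * R := by linarith
  · push Not at hfarx
    have hphys : ‖U.2.1‖ ^ 2 < 2 * U.1 * U.2.2 := by
      rcases hreal with h | h
      · exact h
      · exfalso
        have : V.1 - U.1 ≤ |U.1 - V.1| := by rw [abs_sub_comm]; exact le_abs_self _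
        linarith
    have hU1 : 0 < U.1 := by
      rcases hc1.lt_or_eq with h | h
      · exact h
      · exfalso
        have h0 : 2 * U.1 * U.2.2 = 0 := by rw [← h]; ring
        rw [h0] at hphys
        exact absurd hphys (not_lt.2 (sq_nonneg _))
    have h0 : 0 ≤ R := hpos hU1 hphys
    have hK : 0 ≤ (A / μ + B) * R := mul_nonneg (add_nonneg (div_nonneg hA hμ.le) hB) h0
    linarith

/-- **S3b in the junk-free currency (all kernels).** Given S3a, there is a packing threshold
`η > 0` such that for continuous positive profiles, `σ < 1/2`, every classical solution with
`ρσ³ < η` on `[0,T)`, every flow family and every `t ∈ [0,T)`: `RelEntropyLIntSmallAt` at time `t`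
implies `MeanFieldsCloseAt` at time `t` — for EVERY admissible kernel, with no equation-of-state
input beyond S3a (no `x`-integrability of the coarse-grained entropy is ever needed). -/
theorem meanFieldsCloseAt_of_relEntropyLIntSmallAt (hS3a : Sig.stub_hsRelEtaCoercive) :
    ∃ η : ℝ, 0 < η ∧
      ∀ (a₀ θ₀ : T3 → ℝ) (u₀ : T3 → V3), Continuous a₀ → Continuous θ₀ → Continuous u₀ →
        (∀ x, 0 < a₀ x) → (∀ x, 0 < θ₀ x) →
        ∃ σ₀ : ℝ, 0 < σ₀ ∧ ∀ σ : ℝ, 0 < σ → σ < σ₀ →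
          ∀ (T : ℝ) (ρ θ : ℝ → T3 → ℝ) (u : ℝ → T3 → V3), IsHardSphereEulerSolution σ T ρ u θ →
            (∀ t ∈ Ico 0 T, ∀ x, ρ t x * σ ^ 3 < η) →
            ∀ Φ : (N : ℕ) → HardSphereFlow (Literature.Analysis.FluidPDE.Torus.geometry (Fin 3)) (hsDiameter σ N) (N + 1),
              ∀ t ∈ Ico 0 T, RelEntropyLIntSmallAt σ a₀ u₀ θ₀ Φ ρ u θ t →
                MeanFieldsCloseAt σ a₀ u₀ θ₀ Φ ρ u θ t := by
  obtain ⟨η, hη, H⟩ := hS3a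
  refine ⟨η, hη, fun a₀ θ₀ u₀ ha hθ hu ha0 hθ0 => ⟨1 / 2, by norm_num, ?_⟩⟩
  intro σ hσ hσ2 T ρ θ u hsol hpack Φ t ht hsmall ε hε
  -- (a) compact reference range at time `t`
  have hρc : Continuous (ρ t) := (hsol.smooth_density.isSmooth_slice ht).continuous
  have hθc : Continuous (θ t) := (hsol.smooth_temperature.isSmooth_slice ht).continuous
  have huc : Continuous fun x => ‖u t x‖ := (hsol.smooth_velocity.isSmooth_slice ht).continuous.norm
  obtain ⟨xρm, xρM, hρmM⟩ := exists_min_max_of_continuous hρc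
  obtain ⟨xθm, xθM, hθmM⟩ := exists_min_max_of_continuous hθc
  obtain ⟨_, xuM, huM⟩ := exists_min_max_of_continuous huc
  set ρm := ρ t xρm with hρm_def
  set ρM := ρ t xρM with hρM_def
  set θm := θ t xθm with hθm_def
  set θM := θ t xθM with hθM_def
  set UM := ‖u t xuM‖ with hUM_def
  have hρm : 0 < ρm := hsol.density_pos t ht xρm
  have hθm : 0 < θm := hsol.temperature_pos t ht xθm
  have hρmM' : ρm ≤ ρM := (hρmM xρm).2
  have hθmM' : θm ≤ θM := (hθmM xθm).2
  have hUM : 0 ≤ UM := norm_nonneg _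
  have hpackM : ρM * σ ^ 3 < η := hpack t ht xρM
  -- (b) S3a on this range
  obtain ⟨hpos, ⟨A, B, hA, hB, hlin⟩, hforce⟩ :=
    H ρm ρM θm θM UM σ hρm hρmM' hθm hθmM' hUM hσ hpackM
  set δ : ℝ := min (ε / 2) (ρm / 2) with hδ_def
  have hδ : 0 < δ := lt_min (by positivity) (by positivity)
  have hδε : δ ≤ ε / 2 := min_le_left _ _
  have hδρ : δ ≤ ρm / 2 := min_le_right _ _
  obtain ⟨μ, hμ, r₀, hr₀, hfar⟩ := hforce δ hδ
  set K : ℝ := A / μ + B with hK_def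
  have hK : 0 ≤ K := add_nonneg (div_nonneg hA hμ.le) hB
  set ε' : ℝ := ε / (2 * (K + 1)) with hε'_def
  have hε' : 0 < ε' := by positivity
  have hKε' : K * ε' ≤ ε / 2 := by
    rw [hε'_def, mul_div_assoc']
    rw [div_le_div_iff₀ (by positivity) (by positivity)]
    nlinarith
  obtain ⟨ℓ, hℓ, hsm⟩ := hsmall ε' hε'
  refine ⟨ℓ, hℓ, fun k hk => ?_⟩
  obtain ⟨C, hC0, hkC⟩ := hk.exists_forall_le
  have hr₁ : 0 < min r₀ (ρm / 4) := lt_min hr₀ (by positivity)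
  filter_upwards [hsm k hk, eventually_div_succ_lt C hr₁] with N hN hNr
  haveI : IsProbabilityMeasure (localGibbsLaw σ a₀ u₀ θ₀ N (Φ N)) :=
    isProbabilityMeasure_localGibbsLaw ha hθ hu ha0 hθ0 (by linarith) N (Φ N)
  -- (c)+(d) pathwise bound, almost surely
  have hpath : ∀ᵐ z ∂(localGibbsLaw σ a₀ u₀ θ₀ N (Φ N)),
      ENNReal.ofReal (fieldDistObs σ ρ u θ N (Φ N) k t z) ≤ ENNReal.ofReal δ + ENNReal.ofReal K *
        ∫⁻ x, ENNReal.ofReal (hsRelEta σ (mollState k ((Φ N).flow t z) x)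
          (consState (ρ t x) (u t x) (θ t x))) := by
    filter_upwards [ae_localGibbsLaw_vel_ne σ a₀ u₀ θ₀ N (Φ N) t] with z hz
    refine ofReal_integral_le_add_mul_lintegral hK (fun x => stateDist_nonneg _ _) fun x => ?_
    have hc1 := mollState_fst_nonneg hk.2.1 ((Φ N).flow t z) x
    have hc2 := mollState_snd_snd_nonneg hk.2.1 ((Φ N).flow t z) x
    have hc3 := mollState_norm_sq_le hk.2.1 ((Φ N).flow t z) x
    have htri := mollState_physical_or_fst_le hk.2.1 hkC hz x
    have hr : ρm ≤ ρ t x := (hρmM x).1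
    have hr' : ρ t x ≤ ρM := (hρmM x).2
    have hw : ‖u t x‖ ≤ UM := (huM x).2
    have hϑ : θm ≤ θ t x := (hθmM x).1
    have hϑ' : θ t x ≤ θM := (hθmM x).2
    refine stateDist_le_of_coercive hA hB hμ hδ.le hδρ (by rw [consState_fst]; exact hr) hc1
      (htri.imp_right fun h => h.trans (hNr.le.trans (min_le_right _ _)))
      (fun hU1 hphys => hpos _ _ _ hr hr' hw hϑ hϑ' _ hU1 hphys)
      (hlin _ _ _ hr hr' hw hϑ hϑ' _ hc1 hc2 hc3) fun hfarx => ?_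
    exact hfar _ _ _ hr hr' hw hϑ hϑ' _ hc1 hc2 hc3
      (htri.imp_right fun h => h.trans (hNr.le.trans (min_le_left _ _))) hfarx
  -- (e) integrate in the law
  calc ∫⁻ z, ENNReal.ofReal (fieldDistObs σ ρ u θ N (Φ N) k t z) ∂(localGibbsLaw σ a₀ u₀ θ₀ N (Φ N))
      ≤ ENNReal.ofReal δ + ENNReal.ofReal K * ∫⁻ z, (∫⁻ x, ENNReal.ofReal (hsRelEta σ
          (mollState k ((Φ N).flow t z) x) (consState (ρ t x) (u t x) (θ t x))))
            ∂(localGibbsLaw σ a₀ u₀ θ₀ N (Φ N)) :=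
        lintegral_ofReal_le_of_ae_le ENNReal.ofReal_ne_top hpath
    _ ≤ ENNReal.ofReal δ + ENNReal.ofReal K * ENNReal.ofReal ε' := by gcongr
    _ = ENNReal.ofReal (δ + K * ε') := by
        rw [ENNReal.ofReal_add hδ.le (mul_nonneg hK hε'.le), ENNReal.ofReal_mul hK]
    _ ≤ ENNReal.ofReal ε := ENNReal.ofReal_le_ofReal (by linarith)

/-- **S3b in the junk-free currency, single-kernel conclusion** (the shape consumed by S3c). -/
theorem fieldsCloseViaKernelsAt_of_relEntropyLIntSmallAt (hS3a : Sig.stub_hsRelEtaCoercive) :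
    ∃ η : ℝ, 0 < η ∧
      ∀ (a₀ θ₀ : T3 → ℝ) (u₀ : T3 → V3), Continuous a₀ → Continuous θ₀ → Continuous u₀ →
        (∀ x, 0 < a₀ x) → (∀ x, 0 < θ₀ x) →
        ∃ σ₀ : ℝ, 0 < σ₀ ∧ ∀ σ : ℝ, 0 < σ → σ < σ₀ →
          ∀ (T : ℝ) (ρ θ : ℝ → T3 → ℝ) (u : ℝ → T3 → V3), IsHardSphereEulerSolution σ T ρ u θ →
            (∀ t ∈ Ico 0 T, ∀ x, ρ t x * σ ^ 3 < η) →
            ∀ Φ : (N : ℕ) → HardSphereFlow (Literature.Analysis.FluidPDE.Torus.geometry (Fin 3)) (hsDiameter σ N) (N + 1),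
              ∀ t ∈ Ico 0 T, RelEntropyLIntSmallAt σ a₀ u₀ θ₀ Φ ρ u θ t →
                FieldsCloseViaKernelsAt σ a₀ u₀ θ₀ Φ ρ u θ t := by
  obtain ⟨η, hη, H⟩ := meanFieldsCloseAt_of_relEntropyLIntSmallAt hS3a
  refine ⟨η, hη, fun a₀ θ₀ u₀ ha hθ hu ha0 hθ0 => ?_⟩
  obtain ⟨σ₀, hσ₀, H'⟩ := H a₀ θ₀ u₀ ha hθ hu ha0 hθ0
  exact ⟨σ₀, hσ₀, fun σ hσ hσ' T ρ θ u hsol hpack Φ t ht hsm =>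
    (H' σ hσ hσ' T ρ θ u hsol hpack Φ t ht hsm).fieldsCloseViaKernelsAt exists_isKernel_poly⟩

/-! ### The registered stub -/

/-- **S3b — small mean relative entropy (junk-free currency) forces the mollified fields close in mean
along good kernels.** Given S3a: there is a packing threshold `η > 0` such that for continuous positive
profiles, `σ < σ₀(profiles)`, every classical solution with `ρσ³ < η` on `[0,T)`, every flow family and
every `t ∈ [0,T)`: `RelEntropyLIntSmallAt` at time `t` implies `FieldsCloseViaKernelsAt` at time `t`
(registered signature of the reshaped line; the stronger all-kernel form is
`meanFieldsCloseAt_of_relEntropyLIntSmallAt`). -/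
def Sig.stub_smallRelEntropyFieldsClose : Prop :=
  Sig.stub_hsRelEtaCoercive →
    ∃ η : ℝ, 0 < η ∧
      ∀ (a₀ θ₀ : T3 → ℝ) (u₀ : T3 → V3), Continuous a₀ → Continuous θ₀ → Continuous u₀ →
        (∀ x, 0 < a₀ x) → (∀ x, 0 < θ₀ x) →
        ∃ σ₀ : ℝ, 0 < σ₀ ∧ ∀ σ : ℝ, 0 < σ → σ < σ₀ →
          ∀ (T : ℝ) (ρ θ : ℝ → T3 → ℝ) (u : ℝ → T3 → V3), IsHardSphereEulerSolution σ T ρ u θ →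
            (∀ t ∈ Ico 0 T, ∀ x, ρ t x * σ ^ 3 < η) →
            ∀ Φ : (N : ℕ) → HardSphereFlow (Literature.Analysis.FluidPDE.Torus.geometry (Fin 3)) (hsDiameter σ N) (N + 1),
              ∀ t ∈ Ico 0 T, RelEntropyLIntSmallAt σ a₀ u₀ θ₀ Φ ρ u θ t →
                FieldsCloseViaKernelsAt σ a₀ u₀ θ₀ Φ ρ u θ t

/-- **Registered stub S3b `stub_smallRelEntropyFieldsClose`** (line `registered`, crux
stmt-AtomisticToContinuum-9258), proved: `fieldsCloseViaKernelsAt_of_relEntropyLIntSmallAt`. -/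
theorem stub_smallRelEntropyFieldsClose : Sig.stub_smallRelEntropyFieldsClose :=
  fun hS3a => fieldsCloseViaKernelsAt_of_relEntropyLIntSmallAt hS3a

end Summit.AtomisticToContinuum.HydrodynamicLimit.Theorems.AWS

end
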